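import Summits.ResolutionOfSingularities.ResolutionOfSingularities.Theorems.BirthCountCutKernels3
import HarnessLib

/-! # BirthCountCutCells — FILE D of the decomp-res-lens-4 g38 node «BirthCountCut» (see the module docstring of
`Theorems/BirthCountCutKernels.lean` = FILE A for the thesis, the law, the cut, the honest tags and the sources).

WRITER NOTE (decomp-res writer g13, dedup): the by-name corollary `wildOccultThreefoldBirthFree_holds` of this slice had exactly the
type of the node's own law `noTowerWild_occult_threefold_birthFree` (landed in `BirthCountCutKernels3`; gate `dedup.landed`), so the copy
is dropped — cite `HugValuationCut.noTowerWild_occult_threefold_birthFree` for the class-general, hypothesis-free, port-free kill of the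
birth-free letter; nothing else changed. -/

set_option linter.dupNamespace false
set_option linter.unusedSectionVars false

noncomputable section

open CategoryTheory AlgebraicGeometry IsLocalRing TopologicalSpace
open Literature.AlgebraicGeometry.Resolution
open Summit.ResolutionOfSingularities.ResolutionOfSingularities.Theorems
open WeakOrderReduction ForcedTowerClasses DivergentTowerClasses MonomialTowerClasses
open HugDimensionClasses HugDimensionKernels SurfaceShadowClasses SurfaceShadowKernels
open NearPointCut (SingularClass)
open Scheme.IdealSheafData (vanishingIdeal)

universe u

namespace Summit.ResolutionOfSingularities.ResolutionOfSingularities.Theorems.HugValuationCut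

/-! ## ══ FILE D `Theorems/BirthCountCutCells.lean` (§123; cone-free; imports FILE C) ══ -/

section BirthCells

/-! ### §123 (g38 · NEW) the C₃♮ʳᶠ column cut by the birth letter: C₃♮ʳᶠ = C₃♮ʳᶠ♭ ∧ C₃♮ʳᶠ♯ -/

/-- **CELL C₃♮ʳᶠ♭ (curve-free ruled-recurrent occult divisorial threefold following no line, WITH A BIRTH-FREE PRINCIPAL
COMPANION)** — DECIDED: EMPTY, HYPOTHESIS-FREE, PORT-FREE (`…CurveFreeBirthFreeMixed_holds`). -/
def WildOccultDivisorialThreefoldNonLineRecurrentCompanionCurveFreeBirthFreeMixedWallFreeFreshJumpShallowCompanionKangarooTowersTerminate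
    (n : ℕ) : Prop :=
  NoTowerWild n fun T => (((((((MixedResidual n T ∧ ¬ (LatentFactorTower T ∧ ThreefoldTower T)) ∧ ¬ LatentFactorTower T) ∧
    DivisorialTower T) ∧ ThreefoldTower T) ∧ ¬ FollowsLineTower T) ∧ ¬ IsolatedCompanionTower T) ∧ ¬ FollowsCurveTower T) ∧
    BirthFreeCompanionTower T

/-- **CELL C₃♮ʳᶠ♯ (curve-free ruled-recurrent occult divisorial threefold following no line, BIRTH-RECURRENT: every
principal companion has exceptional near-branches born at arbitrarily late steps) · THE LOCATED RESIDUAL CORE after g38 —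
«THE BIRTH-RECURRENT CURVE-FREE OCCULT THREEFOLD TOWER»** — UNDECIDED · IDEA-NEEDED (no law on record; no certified
inhabitant). -/
def WildOccultDivisorialThreefoldNonLineRecurrentCompanionCurveFreeBirthRecurrentMixedWallFreeFreshJumpShallowCompanionKangarooTowersTerminate
    (n : ℕ) : Prop :=
  NoTowerWild n fun T => (((((((MixedResidual n T ∧ ¬ (LatentFactorTower T ∧ ThreefoldTower T)) ∧ ¬ LatentFactorTower T) ∧
    DivisorialTower T) ∧ ThreefoldTower T) ∧ ¬ FollowsLineTower T) ∧ ¬ IsolatedCompanionTower T) ∧ ¬ FollowsCurveTower T) ∧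
    ¬ BirthFreeCompanionTower T

/-- **EXACT (pure logic): CELL C₃♮ʳᶠ = C₃♮ʳᶠ♭ ∧ C₃♮ʳᶠ♯.** [folklore] -/
theorem wildOccultDivisorialThreefoldNonLineRecurrentCompanionCurveFreeMixed_split (n : ℕ) :
    WildOccultDivisorialThreefoldNonLineRecurrentCompanionCurveFreeMixedWallFreeFreshJumpShallowCompanionKangarooTowersTerminate n ↔
      WildOccultDivisorialThreefoldNonLineRecurrentCompanionCurveFreeBirthFreeMixedWallFreeFreshJumpShallowCompanionKangarooTowersTerminate
          n ∧
        WildOccultDivisorialThreefoldNonLineRecurrentCompanionCurveFreeBirthRecurrentMixedWallFreeFreshJumpShallowCompanionKangarooTowersTerminate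
          n :=
  noTowerWild_split _ BirthFreeCompanionTower

/-- **CELL C₃♮ʳᶠ♭ IS EMPTY — HYPOTHESIS-FREE, PORT-FREE (every `n`).** [folklore] -/
theorem wildOccultDivisorialThreefoldNonLineRecurrentCompanionCurveFreeBirthFreeMixed_holds (n : ℕ) :
    WildOccultDivisorialThreefoldNonLineRecurrentCompanionCurveFreeBirthFreeMixedWallFreeFreshJumpShallowCompanionKangarooTowersTerminate
      n :=
  noTowerWild_mono (fun _ h => ⟨⟨⟨⟨⟨h.1, h.1.1.1.1.1.1.2⟩, h.1.1.1.1.2⟩, h.1.1.2⟩, h.1.2⟩, h.2⟩)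
    (noTowerWild_occult_threefold_birthFree n fun T =>
      ((((((MixedResidual n T ∧ ¬ (LatentFactorTower T ∧ ThreefoldTower T)) ∧ ¬ LatentFactorTower T) ∧
      DivisorialTower T) ∧ ThreefoldTower T) ∧ ¬ FollowsLineTower T) ∧ ¬ IsolatedCompanionTower T) ∧ ¬ FollowsCurveTower T)

/-- **EXACT RE-LOCATION OF CELL C₃♮ʳᶠ, HYPOTHESIS-FREE: C₃♮ʳᶠ ⟺ C₃♮ʳᶠ♯.** [folklore] -/
theorem wildOccultDivisorialThreefoldNonLineRecurrentCompanionCurveFreeMixed_iff_g38 (n : ℕ) :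
    WildOccultDivisorialThreefoldNonLineRecurrentCompanionCurveFreeMixedWallFreeFreshJumpShallowCompanionKangarooTowersTerminate n ↔
      WildOccultDivisorialThreefoldNonLineRecurrentCompanionCurveFreeBirthRecurrentMixedWallFreeFreshJumpShallowCompanionKangarooTowersTerminate
        n :=
  (wildOccultDivisorialThreefoldNonLineRecurrentCompanionCurveFreeMixed_split n).trans
    ⟨fun h => h.2, fun h => ⟨wildOccultDivisorialThreefoldNonLineRecurrentCompanionCurveFreeBirthFreeMixed_holds n, h⟩⟩

/-- down-link, HYPOTHESIS-FREE: C₃♮ʳᶠ ⟹ C₃♮ʳᶠ♯. [folklore] -/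
theorem wildOccultDivisorialThreefoldNonLineRecurrentCompanionCurveFreeBirthRecurrentMixed_of_curveFree {n : ℕ}
    (h : WildOccultDivisorialThreefoldNonLineRecurrentCompanionCurveFreeMixedWallFreeFreshJumpShallowCompanionKangarooTowersTerminate
      n) :
    WildOccultDivisorialThreefoldNonLineRecurrentCompanionCurveFreeBirthRecurrentMixedWallFreeFreshJumpShallowCompanionKangarooTowersTerminate
      n :=
  ((wildOccultDivisorialThreefoldNonLineRecurrentCompanionCurveFreeMixed_split n).mp h).2

/-- **EXACT RE-LOCATION OF CELL C₃♮ʳ, HYPOTHESIS-FREE: C₃♮ʳ ⟺ C₃♮ʳᶠ♯.** [folklore] -/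
theorem wildOccultDivisorialThreefoldNonLineRecurrentCompanionMixed_iff_g38 (n : ℕ) :
    WildOccultDivisorialThreefoldNonLineRecurrentCompanionMixedWallFreeFreshJumpShallowCompanionKangarooTowersTerminate n ↔
      WildOccultDivisorialThreefoldNonLineRecurrentCompanionCurveFreeBirthRecurrentMixedWallFreeFreshJumpShallowCompanionKangarooTowersTerminate
        n :=
  (wildOccultDivisorialThreefoldNonLineRecurrentCompanionMixed_iff_g37 n).trans
    (wildOccultDivisorialThreefoldNonLineRecurrentCompanionCurveFreeMixed_iff_g38 n)

/-- **EXACT RE-LOCATION OF CELL C₃♮ MODULO THE PORT: C₃♮ ⟺ C₃♮ʳᶠ♯.** [folklore] -/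
theorem wildOccultDivisorialThreefoldNonLineMixed_iff_g38_of_port (h640 : SurfaceChainPort) (n : ℕ) :
    WildOccultDivisorialThreefoldNonLineMixedWallFreeFreshJumpShallowCompanionKangarooTowersTerminate n ↔
      WildOccultDivisorialThreefoldNonLineRecurrentCompanionCurveFreeBirthRecurrentMixedWallFreeFreshJumpShallowCompanionKangarooTowersTerminate
        n :=
  (wildOccultDivisorialThreefoldNonLineMixed_iff_g37_of_port h640 n).trans
    (wildOccultDivisorialThreefoldNonLineRecurrentCompanionCurveFreeMixed_iff_g38 n)

/-- **EXACT RE-LOCATION OF CELL C₃ MODULO THE PORT: C₃ ⟺ C₃♮ʳᶠ♯.** [folklore] -/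
theorem wildOccultDivisorialThreefoldMixed_iff_g38_of_port (h640 : SurfaceChainPort) (n : ℕ) :
    WildOccultDivisorialThreefoldMixedWallFreeFreshJumpShallowCompanionKangarooTowersTerminate n ↔
      WildOccultDivisorialThreefoldNonLineRecurrentCompanionCurveFreeBirthRecurrentMixedWallFreeFreshJumpShallowCompanionKangarooTowersTerminate
        n :=
  (wildOccultDivisorialThreefoldMixed_iff_g37_of_port h640 n).trans
    (wildOccultDivisorialThreefoldNonLineRecurrentCompanionCurveFreeMixed_iff_g38 n)

/-- **EXACT RE-LOCATION OF CELL C MODULO THE PORT: C ⟺ C₃♮ʳᶠ♯ ∧ C₄.** [folklore] -/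
theorem wildOccultDivisorialMixed_iff_g38_of_port (h640 : SurfaceChainPort) (n : ℕ) :
    WildOccultDivisorialMixedWallFreeFreshJumpShallowCompanionKangarooTowersTerminate n ↔
      WildOccultDivisorialThreefoldNonLineRecurrentCompanionCurveFreeBirthRecurrentMixedWallFreeFreshJumpShallowCompanionKangarooTowersTerminate
          n ∧
        WildOccultDivisorialNonThreefoldMixedWallFreeFreshJumpShallowCompanionKangarooTowersTerminate n :=
  (wildOccultDivisorialMixed_iff_g37_of_port h640 n).trans
    (Iff.and (wildOccultDivisorialThreefoldNonLineRecurrentCompanionCurveFreeMixed_iff_g38 n) Iff.rfl)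

/-- BY NAME: **no wild curve-free ruled-recurrent occult divisorial threefold tower following no line WITH A BIRTH-FREE
PRINCIPAL COMPANION** (CELL C₃♮ʳᶠ♭; DECIDED, HYPOTHESIS-FREE, PORT-FREE). -/
def NoWildOccultDivisorialThreefoldNonLineRecurrentCompanionCurveFreeBirthFreeMixedTowers : Prop :=
  ∀ n : ℕ, 1 ≤ n →
    WildOccultDivisorialThreefoldNonLineRecurrentCompanionCurveFreeBirthFreeMixedWallFreeFreshJumpShallowCompanionKangarooTowersTerminate
      n

/-- BY NAME: **no wild BIRTH-RECURRENT curve-free ruled-recurrent occult divisorial threefold tower** (CELL C₃♮ʳᶠ♯;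
UNDECIDED — the located residual core after g38). -/
def NoWildOccultDivisorialThreefoldNonLineRecurrentCompanionCurveFreeBirthRecurrentMixedTowers : Prop :=
  ∀ n : ℕ, 1 ≤ n →
    WildOccultDivisorialThreefoldNonLineRecurrentCompanionCurveFreeBirthRecurrentMixedWallFreeFreshJumpShallowCompanionKangarooTowersTerminate
      n

/-- BY NAME: **THE LOCATED RESIDUAL of the lens-4 NP column after g38 — «no wild occult mixed tower that (is a birth-recurrent
curve-free ruled-recurrent divisorial threefold following no line) or is not a threefold»** = (C₃♮ʳᶠ♯ ∧ C₄) ∧ D₄. -/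
def NoWildOccultBirthRecurrentCurveFreeCompanionNonLineMixedTowers : Prop :=
  (NoWildOccultDivisorialThreefoldNonLineRecurrentCompanionCurveFreeBirthRecurrentMixedTowers ∧
      NoWildOccultDivisorialNonThreefoldMixedTowers) ∧
    NoWildOccultNonDivisorialNonThreefoldMixedTowers

/-- **CELL C₃♮ʳᶠ♭ DECIDED BY NAME — HYPOTHESIS-FREE, PORT-FREE.** [folklore] -/
theorem noWildOccultDivisorialThreefoldNonLineRecurrentCompanionCurveFreeBirthFreeMixedTowers_holds :
    NoWildOccultDivisorialThreefoldNonLineRecurrentCompanionCurveFreeBirthFreeMixedTowers := fun n _ =>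
  wildOccultDivisorialThreefoldNonLineRecurrentCompanionCurveFreeBirthFreeMixed_holds n

/-- **EXACT RE-LOCATION BY NAME, HYPOTHESIS-FREE: CELL C₃♮ʳᶠ ⟺ CELL C₃♮ʳᶠ♯.** [folklore] -/
theorem noWildOccultDivisorialThreefoldNonLineRecurrentCompanionCurveFreeMixedTowers_iff_g38 :
    NoWildOccultDivisorialThreefoldNonLineRecurrentCompanionCurveFreeMixedTowers ↔
      NoWildOccultDivisorialThreefoldNonLineRecurrentCompanionCurveFreeBirthRecurrentMixedTowers :=
  ⟨fun h n hn => (wildOccultDivisorialThreefoldNonLineRecurrentCompanionCurveFreeMixed_iff_g38 n).mp (h n hn),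
    fun h n hn => (wildOccultDivisorialThreefoldNonLineRecurrentCompanionCurveFreeMixed_iff_g38 n).mpr (h n hn)⟩

/-- **EXACT RE-LOCATION BY NAME, HYPOTHESIS-FREE: CELL C₃♮ʳ ⟺ CELL C₃♮ʳᶠ♯.** [folklore] -/
theorem noWildOccultDivisorialThreefoldNonLineRecurrentCompanionMixedTowers_iff_g38 :
    NoWildOccultDivisorialThreefoldNonLineRecurrentCompanionMixedTowers ↔
      NoWildOccultDivisorialThreefoldNonLineRecurrentCompanionCurveFreeBirthRecurrentMixedTowers :=
  noWildOccultDivisorialThreefoldNonLineRecurrentCompanionMixedTowers_iff_g37.trans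
    noWildOccultDivisorialThreefoldNonLineRecurrentCompanionCurveFreeMixedTowers_iff_g38

/-- **EXACT RE-LOCATION BY NAME, HYPOTHESIS-FREE: the g37 located residual ⟺ the g38 located residual.** [folklore] -/
theorem noWildOccultCurveFreeRecurrentCompanionNonLineMixedTowers_iff_g38 :
    NoWildOccultCurveFreeRecurrentCompanionNonLineMixedTowers ↔ NoWildOccultBirthRecurrentCurveFreeCompanionNonLineMixedTowers :=
  Iff.and (Iff.and noWildOccultDivisorialThreefoldNonLineRecurrentCompanionCurveFreeMixedTowers_iff_g38 Iff.rfl) Iff.rfl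

/-- **EXACT RE-LOCATION BY NAME, HYPOTHESIS-FREE: the g36 located residual ⟺ the g38 located residual.** [folklore] -/
theorem noWildOccultRecurrentCompanionNonLineMixedTowers_iff_g38 :
    NoWildOccultRecurrentCompanionNonLineMixedTowers ↔ NoWildOccultBirthRecurrentCurveFreeCompanionNonLineMixedTowers :=
  noWildOccultRecurrentCompanionNonLineMixedTowers_iff_g37.trans noWildOccultCurveFreeRecurrentCompanionNonLineMixedTowers_iff_g38

/-- **EXACT RE-LOCATION BY NAME, MODULO THE PORT: CELL C₃♮ ⟺ CELL C₃♮ʳᶠ♯.** [folklore] -/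
theorem noWildOccultDivisorialThreefoldNonLineMixedTowers_iff_g38_of_port (h640 : SurfaceChainPort) :
    NoWildOccultDivisorialThreefoldNonLineMixedTowers ↔
      NoWildOccultDivisorialThreefoldNonLineRecurrentCompanionCurveFreeBirthRecurrentMixedTowers :=
  (noWildOccultDivisorialThreefoldNonLineMixedTowers_iff_g37_of_port h640).trans
    noWildOccultDivisorialThreefoldNonLineRecurrentCompanionCurveFreeMixedTowers_iff_g38

/-- **EXACT RE-LOCATION BY NAME, MODULO THE PORT: CELL C₃ ⟺ CELL C₃♮ʳᶠ♯.** [folklore] -/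
theorem noWildOccultDivisorialThreefoldMixedTowers_iff_g38_of_port (h640 : SurfaceChainPort) :
    NoWildOccultDivisorialThreefoldMixedTowers ↔
      NoWildOccultDivisorialThreefoldNonLineRecurrentCompanionCurveFreeBirthRecurrentMixedTowers :=
  (noWildOccultDivisorialThreefoldMixedTowers_iff_g37_of_port h640).trans
    noWildOccultDivisorialThreefoldNonLineRecurrentCompanionCurveFreeMixedTowers_iff_g38

/-- **EXACT RE-LOCATION BY NAME, MODULO THE PORT: the g35 located residual ⟺ the g38 located residual.** [folklore] -/
theorem noWildOccultNonLineMixedTowers_iff_g38_of_port (h640 : SurfaceChainPort) :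
    NoWildOccultNonLineMixedTowers ↔ NoWildOccultBirthRecurrentCurveFreeCompanionNonLineMixedTowers :=
  (noWildOccultNonLineMixedTowers_iff_g37_of_port h640).trans noWildOccultCurveFreeRecurrentCompanionNonLineMixedTowers_iff_g38

/-- **EXACT RE-LOCATION BY NAME, MODULO THE PORT: the g34 located residual (= C ∧ D₄) ⟺ the g38 located residual.**
[folklore] -/
theorem noWildOccultDivisorialOrNonThreefoldMixedTowers_iff_g38_of_port (h640 : SurfaceChainPort) :
    NoWildOccultDivisorialOrNonThreefoldMixedTowers ↔ NoWildOccultBirthRecurrentCurveFreeCompanionNonLineMixedTowers :=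
  (noWildOccultDivisorialOrNonThreefoldMixedTowers_iff_g37_of_port h640).trans
    noWildOccultCurveFreeRecurrentCompanionNonLineMixedTowers_iff_g38

/-- **EXACT RE-LOCATION BY NAME, MODULO THE PORT: the g33 occult residual (= C ∧ D) ⟺ the g38 located residual.** [folklore] -/
theorem noWildOccultMixedTowers_iff_g38_of_port (h640 : SurfaceChainPort) :
    NoWildOccultMixedTowers ↔ NoWildOccultBirthRecurrentCurveFreeCompanionNonLineMixedTowers :=
  (noWildOccultMixedTowers_iff_g37_of_port h640).trans noWildOccultCurveFreeRecurrentCompanionNonLineMixedTowers_iff_g38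

/-- **EXACT RE-LOCATION BY NAME, MODULO THE PORT: the g32 residual ⟺ CELL B ∧ the g38 located residual.** [folklore] -/
theorem noWildMixedWallFreeFreshJumpShallowCompanionKangarooTowers_iff_g38_of_port (h640 : SurfaceChainPort) :
    NoWildMixedWallFreeFreshJumpShallowCompanionKangarooTowers ↔
      NoWildLatentFactorNonThreefoldMixedTowers ∧ NoWildOccultBirthRecurrentCurveFreeCompanionNonLineMixedTowers :=
  (noWildMixedWallFreeFreshJumpShallowCompanionKangarooTowers_iff_g37_of_port h640).trans
    (Iff.and Iff.rfl noWildOccultCurveFreeRecurrentCompanionNonLineMixedTowers_iff_g38)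

/-- **EXACT RE-LOCATION BY NAME, MODULO THE PORT: the g31 residual ⟺ CELL B ∧ the g38 located residual.** [folklore] -/
theorem noWildNonSurfaceWallFreeFreshJumpShallowCompanionKangarooTowers_iff_g38_of_port (h640 : SurfaceChainPort) :
    NoWildNonSurfaceWallFreeFreshJumpShallowCompanionKangarooTowers ↔
      NoWildLatentFactorNonThreefoldMixedTowers ∧ NoWildOccultBirthRecurrentCurveFreeCompanionNonLineMixedTowers :=
  (noWildNonSurfaceWallFreeFreshJumpShallowCompanionKangarooTowers_iff_g37_of_port h640).trans
    (Iff.and Iff.rfl noWildOccultCurveFreeRecurrentCompanionNonLineMixedTowers_iff_g38)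

/-- down-link (HYPOTHESIS-FREE): the g38 located residual ⟸ the g37 located residual. [folklore] -/
theorem noWildOccultBirthRecurrentCurveFreeCompanionNonLineMixedTowers_of_g37
    (h : NoWildOccultCurveFreeRecurrentCompanionNonLineMixedTowers) : NoWildOccultBirthRecurrentCurveFreeCompanionNonLineMixedTowers :=
  noWildOccultCurveFreeRecurrentCompanionNonLineMixedTowers_iff_g38.mp h

/-- down-link (HYPOTHESIS-FREE): the g38 located residual ⟸ the g36 located residual. [folklore] -/
theorem noWildOccultBirthRecurrentCurveFreeCompanionNonLineMixedTowers_of_g36 (h : NoWildOccultRecurrentCompanionNonLineMixedTowers) :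
    NoWildOccultBirthRecurrentCurveFreeCompanionNonLineMixedTowers :=
  noWildOccultBirthRecurrentCurveFreeCompanionNonLineMixedTowers_of_g37 (noWildOccultCurveFreeRecurrentCompanionNonLineMixedTowers_of_g36 h)

/-- down-link (HYPOTHESIS-FREE): the g38 located residual ⟸ the g35 located residual. [folklore] -/
theorem noWildOccultBirthRecurrentCurveFreeCompanionNonLineMixedTowers_of_g35 (h : NoWildOccultNonLineMixedTowers) :
    NoWildOccultBirthRecurrentCurveFreeCompanionNonLineMixedTowers :=
  noWildOccultBirthRecurrentCurveFreeCompanionNonLineMixedTowers_of_g37 (noWildOccultCurveFreeRecurrentCompanionNonLineMixedTowers_of_g35 h)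

/-- down-link (HYPOTHESIS-FREE): the g38 located residual ⟸ the g34 located residual. [folklore] -/
theorem noWildOccultBirthRecurrentCurveFreeCompanionNonLineMixedTowers_of_g34 (h : NoWildOccultDivisorialOrNonThreefoldMixedTowers) :
    NoWildOccultBirthRecurrentCurveFreeCompanionNonLineMixedTowers :=
  noWildOccultBirthRecurrentCurveFreeCompanionNonLineMixedTowers_of_g37 (noWildOccultCurveFreeRecurrentCompanionNonLineMixedTowers_of_g34 h)

/-- down-link (HYPOTHESIS-FREE): the g38 located residual ⟸ the g32 residual. [folklore] -/
theorem noWildOccultBirthRecurrentCurveFreeCompanionNonLineMixedTowers_of_g32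
    (h : NoWildMixedWallFreeFreshJumpShallowCompanionKangarooTowers) :
    NoWildOccultBirthRecurrentCurveFreeCompanionNonLineMixedTowers :=
  noWildOccultBirthRecurrentCurveFreeCompanionNonLineMixedTowers_of_g37 (noWildOccultCurveFreeRecurrentCompanionNonLineMixedTowers_of_g32 h)

/-- down-link from the TREE aside `NoWildContactFreeOffLocusTowers` (HYPOTHESIS-FREE). [folklore] -/
theorem noWildOccultBirthRecurrentCurveFreeCompanionNonLineMixedTowers_of_aside (h : NoWildContactFreeOffLocusTowers) :
    NoWildOccultBirthRecurrentCurveFreeCompanionNonLineMixedTowers :=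
  noWildOccultBirthRecurrentCurveFreeCompanionNonLineMixedTowers_of_g37
    (noWildOccultCurveFreeRecurrentCompanionNonLineMixedTowers_of_aside h)

/-- up-link (HYPOTHESIS-FREE): the g37 located residual ⟸ the g38 located residual. [folklore] -/
theorem noWildOccultCurveFreeRecurrentCompanionNonLineMixedTowers_of_g38
    (h : NoWildOccultBirthRecurrentCurveFreeCompanionNonLineMixedTowers) : NoWildOccultCurveFreeRecurrentCompanionNonLineMixedTowers :=
  noWildOccultCurveFreeRecurrentCompanionNonLineMixedTowers_iff_g38.mpr h

/-- up-link (HYPOTHESIS-FREE): the g36 located residual ⟸ the g38 located residual. [folklore] -/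
theorem noWildOccultRecurrentCompanionNonLineMixedTowers_of_g38 (h : NoWildOccultBirthRecurrentCurveFreeCompanionNonLineMixedTowers) :
    NoWildOccultRecurrentCompanionNonLineMixedTowers :=
  noWildOccultRecurrentCompanionNonLineMixedTowers_of_g37 (noWildOccultCurveFreeRecurrentCompanionNonLineMixedTowers_of_g38 h)

/-- up-link MODULO THE PORT: the g35 located residual ⟸ the g38 located residual. [folklore] -/
theorem noWildOccultNonLineMixedTowers_of_g38_of_port (h640 : SurfaceChainPort)
    (h : NoWildOccultBirthRecurrentCurveFreeCompanionNonLineMixedTowers) : NoWildOccultNonLineMixedTowers :=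
  noWildOccultNonLineMixedTowers_of_g37_of_port h640 (noWildOccultCurveFreeRecurrentCompanionNonLineMixedTowers_of_g38 h)

/-- **THE RESIDUAL LETTER UNFOLDED BY MECHANISM (kernel)**: in a tower of CELL C₃♮ʳᶠ♯ with a base, every principal factor of
weight `≥ 2` at every stage has exceptional near-branches born at ARBITRARILY LATE steps. [folklore] -/
theorem birthRecurrent_frequently_bornAt {k : Type} [Field k] (T : ForcedTower) (g : T.St 0 ⟶ Spec (.of k))
    (hB : IsBase (T.St 0) g) {n : ℕ} (hD : IsDatum n (T.D 0)) (hrec : ¬ BirthFreeCompanionTower T) {m a b : ℕ}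
    {H K : (T.St m).IdealSheafData} (hF : FactorAt T m a b H K) (ha : 2 ≤ a) (hP : (stalkIdeal H (T.pt m)).IsPrincipal) :
    ∀ j₀, ∃ j, j₀ ≤ j ∧ BornAt T m a H j :=
  frequently_bornAt_of_not_birthFree T g hB hD hrec hF ha hP

end BirthCells

end Summit.ResolutionOfSingularities.ResolutionOfSingularities.Theorems.HugValuationCut
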